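import Summits.MatrixMultiplication.OmegaCensus.SmallFormats.KroneckerPeel
import Summits.MatrixMultiplication.OmegaCensus.SmallFormats.KroneckerWong

/-!
# Kronecker modules IV: the dual module and the second half of the quasi-Weierstraß decomposition

Cell `pub-omega` (unit `pub-omega-tensor-g33`), topic `Summits/MatrixMultiplication/OmegaCensus` (sub-folder `SmallFormats`).
Framing (verbatim): lottery ticket; floor = certified bounds/negative ranges. HONEST FRAMING: general linear algebra toward
PROVING `KroneckerBlockForm97`; nothing on `ω` here.

The *dual* of the Kronecker module `a b : U →ₗ[k] V` is `aᵀ bᵀ : V* →ₗ U*` (`LinearMap.dualMap`). Chains of `(a, b)`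
reverse to chains of `(b, a)` (`ChainFree.swap`). The annihilator DICTIONARY relates the Wong sequences of the module and
of its dual: `(X n)^⊥ = aᵀ(Y'' n)`, `(b (X n))^⊥ = Y'' (n+1)`, `(a (Y n))^⊥ = X'' n`, `(Y (n+1))^⊥ = bᵀ(X'' n)`
(`X'' Y''` = Wong sequences of `(aᵀ, bᵀ)`), via `(S.comap f)^⊥ = fᵀ(S^⊥)` (`KroneckerPeel`) and `(T.map f)^⊥ = (fᵀ)⁻¹(T^⊥)`.
Consequently, if the DUAL module is chain-free (no `L_ε` blocks) then `Xi ⊔ Yi = ⊤` and `b Xi ⊔ a Yi = ⊤` — together with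
`KroneckerWong` this is the basis-free quasi-Weierstraß decomposition `U = Xi ⊕ Yi`, `V = b Xi ⊕ a Yi` of a module that
is chain-free on both sides (`regular_decomposition`).
-/

namespace Summit.MatrixMultiplication.OmegaCensus.SmallFormats.Kronecker

open Module Submodule

variable {k : Type*} [Field k] {U V : Type*} [AddCommGroup U] [Module k U] [AddCommGroup V] [Module k V]
variable {a b : U →ₗ[k] V}

/-! ## Reversal: chains of `(a, b)` are chains of `(b, a)` read backwards -/

/-- Reversal of a sequence supported on `t ≤ m`. -/
def reverseSeq (m : ℕ) (x : ℕ → U) : ℕ → U := fun t => if t ≤ m then x (m - t) else 0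

/-- The reversal of a chain of `(a, b)` is a chain of `(b, a)`. -/
theorem IsChain.reverse {m : ℕ} {x : ℕ → U} (hx : IsChain a b m x) : IsChain b a m (reverseSeq m x) := by
  refine ⟨by simpa [reverseSeq] using hx.b_last, fun t => ?_, fun t ht => by simp [reverseSeq, Nat.not_le.mpr ht]⟩
  simp only [reverseSeq]
  rcases Nat.lt_or_ge t m with h | h
  · rw [if_pos (by omega), if_pos h.le, show m - t = (m - (t + 1)) + 1 by omega, hx.rel]
  · rw [if_neg (by omega), map_zero]
    rcases Nat.eq_or_lt_of_le h with rfl | h'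
    · rw [if_pos le_rfl, Nat.sub_self, hx.head]
    · rw [if_neg (by omega), map_zero]

/-- Chain-freeness is symmetric in `(a, b)`. -/
theorem ChainFree.swap (hF : ChainFree a b) : ChainFree b a := by
  intro m x hx
  have h := hF m _ hx.reverse
  funext t
  rcases Nat.lt_or_ge m t with ht | ht
  · exact hx.supp t ht
  · have := congrFun h (m - t)
    simpa [reverseSeq, show m - (m - t) = t by omega] using this

/-! ## Annihilators of images -/

/-- **Annihilator of an image**: `(T.map f)^⊥ = (fᵀ)⁻¹(T^⊥)`. -/
theorem dualAnnihilator_map_eq' (f : U →ₗ[k] V) (T : Submodule k U) :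
    (T.map f).dualAnnihilator = T.dualAnnihilator.comap f.dualMap := by
  ext φ
  simp only [Submodule.mem_dualAnnihilator, Submodule.mem_comap, LinearMap.dualMap_apply]
  constructor
  · intro h u hu; exact h _ (Submodule.mem_map_of_mem hu)
  · intro h v hv
    obtain ⟨u, hu, rfl⟩ := Submodule.mem_map.mp hv
    exact h u hu

/-! ## The dictionary between the Wong sequences of the module and of its dual -/

section Dictionary

variable (a b)

/-- `(X n)^⊥ = aᵀ (Y'' n)`. -/
theorem dualAnnihilator_X (n : ℕ) :
    (X a b n).dualAnnihilator = (Y a.dualMap b.dualMap n).map a.dualMap := by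
  induction n with
  | zero => simp [X_zero, Y_zero, Submodule.dualAnnihilator_top]
  | succ n ih =>
      rw [X_succ, dualAnnihilator_comap_eq, dualAnnihilator_map_eq', ih, Y_succ]

/-- `(b (X n))^⊥ = Y'' (n+1)`. -/
theorem dualAnnihilator_map_X (n : ℕ) :
    ((X a b n).map b).dualAnnihilator = Y a.dualMap b.dualMap (n + 1) := by
  rw [dualAnnihilator_map_eq', dualAnnihilator_X, Y_succ]

/-- `(a (Y n))^⊥ = X'' n`. -/
theorem dualAnnihilator_map_Y (n : ℕ) :
    ((Y a b n).map a).dualAnnihilator = X a.dualMap b.dualMap n := by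
  induction n with
  | zero => simp [X_zero, Y_zero, Submodule.dualAnnihilator_bot]
  | succ n ih =>
      rw [dualAnnihilator_map_eq', Y_succ, dualAnnihilator_comap_eq, ih, X_succ]

/-- `(Y (n+1))^⊥ = bᵀ (X'' n)`. -/
theorem dualAnnihilator_Y_succ (n : ℕ) :
    (Y a b (n + 1)).dualAnnihilator = (X a.dualMap b.dualMap n).map b.dualMap := by
  rw [Y_succ, dualAnnihilator_comap_eq, dualAnnihilator_map_Y]

end Dictionary

/-! ## The second half of the quasi-Weierstraß decomposition -/

section Regular

variable [FiniteDimensional k U] [FiniteDimensional k V]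

/-- A subspace with zero annihilator is everything. -/
theorem eq_top_of_dualAnnihilator_eq_bot {S : Submodule k U} (h : S.dualAnnihilator = ⊥) : S = ⊤ := by
  apply Submodule.eq_top_of_finrank_eq
  have := Subspace.finrank_add_finrank_dualAnnihilator_eq S
  rw [h, finrank_bot] at this
  omega

variable (a b)

omit [FiniteDimensional k U] [FiniteDimensional k V] in
/-- A common stable index for the Wong sequences of the module and of its dual. -/
theorem stable_index : finrank k U ≤ finrank k U + finrank k V ∧ finrank k (Dual k V) ≤ finrank k U + finrank k V := by
  rw [Subspace.dual_finrank_eq]; omega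

/-- `Xi^⊥ = aᵀ Yi''`. -/
theorem dualAnnihilator_Xi : (Xi a b).dualAnnihilator = (Yi a.dualMap b.dualMap).map a.dualMap := by
  obtain ⟨h1, h2⟩ := stable_index (k := k) (U := U) (V := V)
  rw [← X_eq_Xi a b _ h1, dualAnnihilator_X, Y_eq_Yi _ _ _ h2]

/-- `Yi^⊥ = bᵀ Xi''`. -/
theorem dualAnnihilator_Yi : (Yi a b).dualAnnihilator = (Xi a.dualMap b.dualMap).map b.dualMap := by
  obtain ⟨h1, h2⟩ := stable_index (k := k) (U := U) (V := V)
  rw [← Y_eq_Yi a b _ (Nat.le_succ_of_le h1), dualAnnihilator_Y_succ, X_eq_Xi _ _ _ h2]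

/-- `(b Xi)^⊥ = Yi''`. -/
theorem dualAnnihilator_map_Xi : ((Xi a b).map b).dualAnnihilator = Yi a.dualMap b.dualMap := by
  obtain ⟨h1, h2⟩ := stable_index (k := k) (U := U) (V := V)
  rw [← X_eq_Xi a b _ h1, dualAnnihilator_map_X, Y_eq_Yi _ _ _ (Nat.le_succ_of_le h2)]

/-- `(a Yi)^⊥ = Xi''`. -/
theorem dualAnnihilator_map_Yi : ((Yi a b).map a).dualAnnihilator = Xi a.dualMap b.dualMap := by
  obtain ⟨h1, h2⟩ := stable_index (k := k) (U := U) (V := V)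
  rw [← Y_eq_Yi a b _ h1, dualAnnihilator_map_Y, X_eq_Xi _ _ _ h2]

variable {a b}

/-- **`Xi ⊔ Yi = ⊤`** when the dual module is chain-free. -/
theorem ChainFree.Xi_sup_Yi (hF : ChainFree a.dualMap b.dualMap) : Xi a b ⊔ Yi a b = ⊤ := by
  apply eq_top_of_dualAnnihilator_eq_bot
  rw [Submodule.dualAnnihilator_sup_eq, dualAnnihilator_Xi, dualAnnihilator_Yi, inf_comm]
  exact hF.map_Xi_inf_map_Yi

/-- **`b Xi ⊔ a Yi = ⊤`** when the dual module is chain-free. -/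
theorem ChainFree.map_Xi_sup_map_Yi (hF : ChainFree a.dualMap b.dualMap) : (Xi a b).map b ⊔ (Yi a b).map a = ⊤ := by
  apply eq_top_of_dualAnnihilator_eq_bot
  rw [Submodule.dualAnnihilator_sup_eq, dualAnnihilator_map_Xi, dualAnnihilator_map_Yi, inf_comm]
  exact hF.Xi_inf_Yi

/-- **Quasi-Weierstraß decomposition (basis-free).** If the module and its dual are both chain-free (no `L_ηᵀ` and no
`L_ε` blocks) then `U = Xi ⊕ Yi` and `V = b Xi ⊕ a Yi`, both summands are `a,b`-invariant pairs, `b : Xi → b Xi` and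
`a : Yi → a Yi` are bijective. -/
theorem regular_decomposition (hF : ChainFree a b) (hF' : ChainFree a.dualMap b.dualMap) :
    IsCompl (Xi a b) (Yi a b) ∧ IsCompl ((Xi a b).map b) ((Yi a b).map a) ∧
      (∀ u ∈ Xi a b, a u ∈ (Xi a b).map b) ∧ (∀ u ∈ Yi a b, b u ∈ (Yi a b).map a) ∧
      (∀ u ∈ Xi a b, b u = 0 → u = 0) ∧ (∀ u ∈ Yi a b, a u = 0 → u = 0) :=
  ⟨⟨disjoint_iff.mpr hF.Xi_inf_Yi, codisjoint_iff.mpr hF'.Xi_sup_Yi⟩,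
    ⟨disjoint_iff.mpr hF.map_Xi_inf_map_Yi, codisjoint_iff.mpr hF'.map_Xi_sup_map_Yi⟩,
    fun _ hu => a_mem_map_b_Xi a b hu, fun _ hu => b_mem_map_a_Yi a b hu,
    fun _ hu hb => hF.b_inj_Xi hu hb, fun _ hu ha => hF.a_inj_Yi hu ha⟩

end Regular

end Summit.MatrixMultiplication.OmegaCensus.SmallFormats.Kronecker
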